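import Summits.AtomisticToContinuum.HydrodynamicLimit.Theorems.JParityClosureLocalSecondLawStrainFromCoarseBounds

/-!
# Strain tightness and thermal-strain tightness from coarse bounds at the doubled radius
(stmt-AtomisticToContinuum-13081, line `exact-entropy-ledger-three-passivities`; file 2 of 2 of the W3 package, the
crux-frame reductions over the deterministic core `…StrainFromCoarseBounds.lean`)

Two of the seven typed inputs of the line's composition — `StrainTightness` (2nd hypothesis of
`passivityKinetic_of_isotropy`, `…PassivityKineticOfIsotropy.lean`: `r |∂ₖu_{r,l}| ≤ K` on `[0,τ] × 𝕋³` off an event of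
probability `≤ δ` on the regular range) and `ThermalStrainTightness` (2nd hypothesis of `passivityThermal_of_closure`,
`…PassivityThermalOfClosure.lean`: the same for `r |∂ₖθ_r|`) — are reduced to ONE statement of law-of-large-numbers
type in the crux's own frame, INLINED as the hypothesis of both theorems (no `def … : Prop`; its Lean text is displayed
below, ready to be registered as a stub `CoarseBounds2r` of the crux):

* `CoarseBounds2r` — for every floor/cap `(c, η₁)` and `δ > 0` there are caps `D, E > 0` such that for `r < r₀`,
  `N ≥ N₀(r)`, outside an event of probability `≤ δ` the regular orbits satisfy `ρ_{2r} ≤ D` and `e_{2r} ≤ E` on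
  `[0,τ] × 𝕋³` (coarse density and coarse kinetic energy at the DOUBLED radius; pre-shock a consequence of the
  fixed-time field LLN on `[0,τ]` with `D = sup ρ + 1`, `E = sup e + 1`, plus a Lipschitz clock / equicontinuity in time,
  exactly like the density cap of `Theorems/JParityClosureDensityCapGridUpgrade.lean`).

`strain_of_coarseBounds : CoarseBounds2r → StrainTightness` and
`thermalStrain_of_coarseBounds : CoarseBounds2r → ThermalStrainTightness` (conclusions verbatim the typed inputs): with
`K = 32(D + 2E)(1/c + 8D/c²)` resp. `K' = (2/3)(64E/c + 512DE/c² + K(4D + 8E)/c)` and the same `σ₀, r₀, N₀`, the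
deterministic core (`strainBound_of_coarseBounds`, `thermalStrainBound_of_coarseBounds`) gives the event inclusion
`{Regular ∧ ∃ (s,x,k,l), K < r|∂ₖu_{r,l}|} ⊆ {Regular ∧ ∃ (s,x), D < ρ_{2r} ∨ E < e_{2r}}`; `measure_mono`.

References: H. Spohn, *Large Scale Dynamics of Interacting Particles* (1991), Part I §3.
-/

noncomputable section

namespace Summit.AtomisticToContinuum.HydrodynamicLimit.Theorems.LocalSecondLawLedger

open scoped BigOperators Topology Classical MeasureTheory ENNReal InnerProductSpace
open Filter Set MeasureTheory
open Literature.MathematicalPhysics.KineticTheory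
open Literature.Analysis.FluidPDE
open Summit.AtomisticToContinuum.HydrodynamicLimit.Theorems.LocalSecondLawNegative

variable {N : ℕ}


/-! ### Antecedent `CoarseBounds2r` (inlined as the hypothesis of both reductions)
**Coarse bounds at the doubled radius** (in probability, on the regular event), in the crux's frame (quantifier
conventions of `StrainTightness`; `c, η₁` enter only through `Regular`).  Lean text (namespace/opens of this file),
ready to be registered as a stub:
```
∀ (a₀ θ₀ : T3 → ℝ) (u₀ : T3 → V3), Continuous a₀ → Continuous θ₀ → Continuous u₀ → (∀ x, 0 < a₀ x) → (∀ x, 0 < θ₀ x) →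
∃ σ₀ : ℝ, 0 < σ₀ ∧ ∀ σ : ℝ, 0 < σ → σ < σ₀ → ∀ (T : ℝ) (ρ θ : ℝ → T3 → ℝ) (u : ℝ → T3 → V3), IsHardSphereEulerSolution
σ T ρ u θ → ∀ Φ : (N : ℕ) → Flow σ N, TendstoHydroFieldsAt (fun N => localGibbsLaw σ a₀ u₀ θ₀ N (Φ N)) Φ ρ u θ 0 → 0 <
T → ∀ τ : ℝ, 0 < τ → ∀ c η₁ : ℝ, 0 < c → ∀ δ : ℝ, 0 < δ → ∃ D : ℝ, 0 < D ∧ ∃ E : ℝ, 0 < E ∧ ∃ r₀ : ℝ, 0 < r₀ ∧ ∀ r :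
ℝ, 0 < r → r < r₀ → ∃ N₀ : ℕ, ∀ N : ℕ, N₀ ≤ N → localGibbsLaw σ a₀ u₀ θ₀ N (Φ N) {z | Regular σ r τ c η₁ (Φ N) z ∧ ∃ s
∈ Set.Icc (0 : ℝ) τ, ∃ x : T3, D < rhoC (2 * r) ((Φ N).flow s z) x ∨ E < kinC (2 * r) ((Φ N).flow s z) x} ≤
ENNReal.ofReal δ
```
-/


/-- **Strain tightness from coarse bounds at the doubled radius** (`strain_of_coarseBounds`): under `CoarseBounds2r`
the typed input `StrainTightness` of `passivityKinetic_of_isotropy` holds VERBATIM, with `K = 32(D + 2E)(1/c + 8D/c²)`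
(event inclusion by `strainBound_of_coarseBounds`, `measure_mono`). -/
theorem strain_of_coarseBounds :
  (∀ (a₀ θ₀ : T3 → ℝ) (u₀ : T3 → V3), Continuous a₀ → Continuous θ₀ → Continuous u₀ → (∀ x, 0 < a₀ x) → (∀ x, 0 < θ₀ x) → ∃ σ₀ : ℝ, 0 < σ₀ ∧ ∀ σ : ℝ, 0 < σ → σ < σ₀ → ∀ (T : ℝ) (ρ θ : ℝ → T3 → ℝ) (u : ℝ → T3 → V3), IsHardSphereEulerSolution σ T ρ u θ → ∀ Φ : (N : ℕ) → Flow σ N, TendstoHydroFieldsAt (fun N => localGibbsLaw σ a₀ u₀ θ₀ N (Φ N)) Φ ρ u θ 0 → 0 < T → ∀ τ : ℝ, 0 < τ → ∀ c η₁ : ℝ, 0 < c → ∀ δ : ℝ, 0 < δ → ∃ D : ℝ, 0 < D ∧ ∃ E : ℝ, 0 < E ∧ ∃ r₀ : ℝ, 0 < r₀ ∧ ∀ r : ℝ, 0 < r → r < r₀ → ∃ N₀ : ℕ, ∀ N : ℕ, N₀ ≤ N → localGibbsLaw σ a₀ u₀ θ₀ N (Φ N) {z | Regular σ r τ c η₁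 (Φ N) z ∧ ∃ s ∈ Set.Icc (0 : ℝ) τ, ∃ x : T3, D < rhoC (2 * r) ((Φ N).flow s z) x ∨ E < kinC (2 * r) ((Φ N).flow s z) x} ≤ ENNReal.ofReal δ) → ∀ (a₀ θ₀ : T3 → ℝ) (u₀ : T3 → V3), Continuous a₀ → Continuous θ₀ → Continuous u₀ → (∀ x, 0 < a₀ x) → (∀ x, 0 < θ₀ x) → ∃ σ₀ : ℝ, 0 < σ₀ ∧ ∀ σ : ℝ, 0 < σ → σ < σ₀ → ∀ (T : ℝ) (ρ θ : ℝ → T3 → ℝ) (u : ℝ → T3 → V3), IsHardSphereEulerSolution σ T ρ u θ → ∀ Φ : (N : ℕ) → Flow σ N, TendstoHydroFieldsAt (fun N => localGibbsLaw σ a₀ u₀ θ₀ N (Φ N)) Φ ρ u θ 0 → 0 < T → ∀ τ : ℝ, 0 < τ → ∀ c η₁ : ℝ, 0 < c → ∀ δ : ℝ, 0 < δ → ∃ K : ℝ, 0 < K ∧ ∃ r₀ : ℝ, 0 < r₀ ∧ ∀ r : ℝ, 0 < r → r < r₀ → ∃ N₀ : ℕ, ∀ N : ℕ, N₀ ≤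 N → localGibbsLaw σ a₀ u₀ θ₀ N (Φ N) {z | Regular σ r τ c η₁ (Φ N) z ∧ ∃ s ∈ Set.Icc (0 : ℝ) τ, ∃ x : T3, ∃ k l : Fin 3, K < r * |pD k (fun y => uC r ((Φ N).flow s z) y l) x|} ≤ ENNReal.ofReal δ := by
  intro hCB a₀ θ₀ u₀ ha hθ hu ha0 hθ0
  obtain ⟨σ₀, hσ₀, H⟩ := hCB a₀ θ₀ u₀ ha hθ hu ha0 hθ0
  refine ⟨σ₀, hσ₀, fun σ hσ hσlt T ρ θ u hsol Φ h0 hT τ hτ c η₁ hc δ hδ => ?_⟩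
  obtain ⟨D, hD, E, hE, r₀, hr₀, H'⟩ := H σ hσ hσlt T ρ θ u hsol Φ h0 hT τ hτ c η₁ hc δ hδ
  refine ⟨32 * (D + 2 * E) * (1 / c + 8 * D / c ^ 2), by positivity, r₀, hr₀, fun r hr hrr => ?_⟩
  obtain ⟨N₀, HN⟩ := H' r hr hrr
  refine ⟨N₀, fun N hN => le_trans (measure_mono ?_) (HN N hN)⟩
  rintro z ⟨hReg, s, hs, x, k, l, hK⟩
  refine ⟨hReg, ?_⟩
  by_contra hcon
  push Not at hcon
  exact absurd (strainBound_of_coarseBounds hr hc hReg hcon s hs x k l) (not_le.2 hK)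

/-- **Thermal-strain tightness from coarse bounds at the doubled radius** (`thermalStrain_of_coarseBounds`): under
`CoarseBounds2r` the typed input `ThermalStrainTightness` of `passivityThermal_of_closure` holds VERBATIM, with
`K' = (2/3)(64E/c + 512DE/c² + 32(D + 2E)(1/c + 8D/c²)(4D + 8E)/c)` (event inclusion by
`thermalStrainBound_of_coarseBounds`, `measure_mono`). -/
theorem thermalStrain_of_coarseBounds :
  (∀ (a₀ θ₀ : T3 → ℝ) (u₀ : T3 → V3), Continuous a₀ → Continuous θ₀ → Continuous u₀ → (∀ x, 0 < a₀ x) → (∀ x, 0 < θ₀ x) → ∃ σ₀ : ℝ, 0 < σ₀ ∧ ∀ σ : ℝ, 0 < σ → σ < σ₀ → ∀ (T : ℝ) (ρ θ : ℝ → T3 → ℝ) (u : ℝ → T3 → V3), IsHardSphereEulerSolution σ T ρ u θ → ∀ Φ : (N : ℕ) → Flow σ N, TendstoHydroFieldsAt (fun N => localGibbsLaw σ a₀ u₀ θ₀ N (Φ N)) Φ ρ u θ 0 → 0 < T → ∀ τ : ℝ, 0 < τ → ∀ c η₁ : ℝ, 0 < c → ∀ δ : ℝ, 0 < δ → ∃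 D : ℝ, 0 < D ∧ ∃ E : ℝ, 0 < E ∧ ∃ r₀ : ℝ, 0 < r₀ ∧ ∀ r : ℝ, 0 < r → r < r₀ → ∃ N₀ : ℕ, ∀ N : ℕ, N₀ ≤ N → localGibbsLaw σ a₀ u₀ θ₀ N (Φ N) {z | Regular σ r τ c η₁ (Φ N) z ∧ ∃ s ∈ Set.Icc (0 : ℝ) τ, ∃ x : T3, D < rhoC (2 * r) ((Φ N).flow s z) x ∨ E < kinC (2 * r) ((Φ N).flow s z) x} ≤ ENNReal.ofReal δ) → ∀ (a₀ θ₀ : T3 → ℝ) (u₀ : T3 → V3), Continuous a₀ → Continuous θ₀ → Continuous u₀ → (∀ x, 0 < a₀ x) → (∀ x, 0 < θ₀ x) → ∃ σ₀ : ℝ, 0 < σ₀ ∧ ∀ σ : ℝ, 0 < σ → σ < σ₀ → ∀ (T : ℝ) (ρ θ : ℝ → T3 → ℝ) (u : ℝ → T3 → V3), IsHardSphereEulerSolution σ T ρ u θ → ∀ Φ : (N : ℕ) → Flow σ N, TendstoHydroFieldsAt (fun N => localGibbsLaw σ a₀ u₀ θ₀ N (Φ N)) Φ ρ u θ 0 →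 0 < T → ∀ τ : ℝ, 0 < τ → ∀ c η₁ : ℝ, 0 < c → ∀ δ : ℝ, 0 < δ → ∃ K : ℝ, 0 < K ∧ ∃ r₀ : ℝ, 0 < r₀ ∧ ∀ r : ℝ, 0 < r → r < r₀ → ∃ N₀ : ℕ, ∀ N : ℕ, N₀ ≤ N → localGibbsLaw σ a₀ u₀ θ₀ N (Φ N) {z | Regular σ r τ c η₁ (Φ N) z ∧ ∃ s ∈ Set.Icc (0 : ℝ) τ, ∃ x : T3, ∃ k : Fin 3, K < r * |pD k (fun y => thetaC r ((Φ N).flow s z) y) x|} ≤ ENNReal.ofReal δ := by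
  intro hCB a₀ θ₀ u₀ ha hθ hu ha0 hθ0
  obtain ⟨σ₀, hσ₀, H⟩ := hCB a₀ θ₀ u₀ ha hθ hu ha0 hθ0
  refine ⟨σ₀, hσ₀, fun σ hσ hσlt T ρ θ u hsol Φ h0 hT τ hτ c η₁ hc δ hδ => ?_⟩
  obtain ⟨D, hD, E, hE, r₀, hr₀, H'⟩ := H σ hσ hσlt T ρ θ u hsol Φ h0 hT τ hτ c η₁ hc δ hδ
  refine ⟨2 / 3 * (64 * E / c + 8 * E * (64 * D) / c ^ 2 +
    32 * (D + 2 * E) * (1 / c + 8 * D / c ^ 2) * ((4 * D + 8 * E) / c)), by positivity, r₀, hr₀, fun r hr hrr => ?_⟩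
  obtain ⟨N₀, HN⟩ := H' r hr hrr
  refine ⟨N₀, fun N hN => le_trans (measure_mono ?_) (HN N hN)⟩
  rintro z ⟨hReg, s, hs, x, k, hK⟩
  refine ⟨hReg, ?_⟩
  by_contra hcon
  push Not at hcon
  exact absurd (thermalStrainBound_of_coarseBounds hr hc hReg hcon s hs x k) (not_le.2 hK)

end Summit.AtomisticToContinuum.HydrodynamicLimit.Theorems.LocalSecondLawLedger

end
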